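import Summits.AtomisticToContinuum.HydrodynamicLimit.Theorems.TwoClocksTransferEntropyClockTailRateCutoff
import HarnessLib

/-!
# The re-orthogonalised band truncation of the suprathermal heat-flux remainder, over a parameter space
# (helper 1/2 for the registered stub `stub_bandShiftStatics`, line `IdeatorOneSketch`, crux `HydroLimitProfilewiseBand`,
# stmt-AtomisticToContinuum-17372; the stub is shared verbatim with the sibling crux `HydroLimitInBand`, stmt-9133, line v16)

Static Gaussian analysis. For a continuous temperature `0 < θ ≤ θM` on a first-countable parameter space `X`, fields `u b`
(`‖u‖ ≤ U`, `‖b‖ ≤ Bb`) and a continuous cut-off profile `G(p,s′)` bounded by `C_G` on `s′ ≥ 0` with the reduced orthogonality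
`b_k(p)·E[ξ₀² G(p,θ‖ξ‖²)] = 0`, the REMAINDER profile `r = s′ − 5θ − G` (the suprathermal heat-flux remainder `(b·w) r(p,|w|²)`
of the rate cubic channel, cubic in `w`) splits at every level `K ≥ 1` into a BAND part `(b·w)G_b(p,|w|²)`,
`G_b = r·χ_{K²} − ρ ω₀(·/θ)` — bounded, of growth `≤ C_B K(1+|v|²)` with `C_B` independent of `K`, orthogonal to `1, v_k, |v|²` —
and a remainder `≤ Bb(1 + 5θM + C_G)·1{K < |w|}|w|³ + A e^{-cK}` for ANY rate `c`. Construction = the landed quantitative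
cut-off `TransferEntropyClockTailRateCutoff.tailRate_cutoffQuant` (crux 16625) with `s′ − 5θ` replaced by `r`: tent `ω₀` on
`[1,3]` in the reduced variable (universal reference moment `m₀ > 0`), amplitude `ρ = R/m₀`, `R(p) = E[ξ₀² rχ]` continuous by
dominated convergence; orthogonality from the scalar condition `E[ξ₀² G_b] = R − ρm₀ = 0` (`odd_member_orth`); where `b(p) ≠ 0`
the Euler orthogonality `E[ξ₀²(‖ξ‖² − 5)] = 0` and the hypothesis give `R = −E[ξ₀² r(1 − χ)]`, a Gaussian tail dominated through
Fernique by `(6θM + C_G)E[(1+‖ξ‖²)³e^{c√θM‖ξ‖}]e^{-cK}`; where `b(p) = 0` the functional vanishes.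
-/

noncomputable section

open MeasureTheory Filter Set Topology
open scoped ENNReal

namespace Summit.AtomisticToContinuum.HydrodynamicLimit.Theorems.HydroLimitProfilewiseBandBandShift

open Literature.MathematicalPhysics.KineticTheory Literature.Analysis.FluidPDE Literature.Analysis.FunctionSpaces
open ProbabilityTheory
open Summit.AtomisticToContinuum.HydrodynamicLimit.Theorems.KineticCurrentsWindowLDUniformSketch.ClassTruncation
open Summit.AtomisticToContinuum.HydrodynamicLimit.Theorems.ClampedCurrentsDockCutoff
  (cutoff_eq_one tent_props isOpenPosMeasure_stdGaussian_V3 odd_member_orth)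
open Summit.AtomisticToContinuum.HydrodynamicLimit.Theorems.TransferEntropyClockTailRateCutoff
  (integral_coord_sq_mul_norm_sq_sub_five integrable_tailWeight one_le_exp_rate_of_sq_le growth_arith)

-- adapted from Summits/.../TwoClocksTransferEntropyClockTailRateCutoff.lean (`tailRate_cutoffQuant`): profile `s′ − 5θ − G`
-- in place of `s′ − 5θ`; about 20 `set` constants and 60 intermediate facts in ONE declaration
set_option maxHeartbeats 800000 in -- one declaration: the whole band-truncation bookkeeping (elaborates under 800000, not 400000)
/-- **The band truncation over a parameter space.** For `θ : X → ℝ` continuous with `0 < θ ≤ θM`, fields `u b : X → V3` with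
`‖u‖ ≤ U`, `‖b‖ ≤ Bb`, and a continuous profile `G` with `|G(p,s′)| ≤ C_G` on `s′ ≥ 0` whose odd functional `(b·w)G(p,|w|²)` is
reduced-orthogonal (`b_k(p)·E[ξ₀² G(p,θ‖ξ‖²)] = 0`; from `(b·w)G ⊥ v_k`, helper 2/2): there is `C_B ≥ 1` and, for every rate `c > 0`, constants `A ≥ 0`, `K₀ ≥ 1`
such that for every level `K ≥ K₀` a continuous profile `G_b` exists with `(b·w)G_b(p,|w|²)` bounded, of growth
`≤ C_B K (1+‖v‖²)`, orthogonal to `1, v_k, ‖v‖²`, and with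
`|(b·w)(|w|² − 5θ − G(p,|w|²)) − (b·w)G_b(p,|w|²)| ≤ Bb(1 + 5θM + C_G)·1{K < |w|}|w|³ + A e^{-cK}`. [folklore] -/
theorem bandShift_param {X : Type*} [TopologicalSpace X] [FirstCountableTopology X]
    {θ : X → ℝ} (hθc : Continuous θ) (u b : X → V3) {G : X × ℝ → ℝ} (hGc : Continuous G)
    {θM U Bb C_G : ℝ} (hθpos : ∀ p, 0 < θ p) (hθM0 : 0 < θM) (hθM : ∀ p, θ p ≤ θM)
    (hU : ∀ p, ‖u p‖ ≤ U) (hBb0 : 0 ≤ Bb) (hBb : ∀ p, ‖b p‖ ≤ Bb) (hCG0 : 0 ≤ C_G)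
    (hGbd : ∀ (p : X) (s : ℝ), 0 ≤ s → |G (p, s)| ≤ C_G)
    (hEG : ∀ (p : X) (k : Fin 3), b p k * ∫ ξ : V3, ξ 0 * ξ 0 * G (p, θ p * ‖ξ‖ ^ 2) ∂stdGaussian V3 = 0) :
    ∃ CB : ℝ, 1 ≤ CB ∧ ∀ c : ℝ, 0 < c → ∃ A : ℝ, 0 ≤ A ∧ ∃ K₀ : ℝ, 1 ≤ K₀ ∧ ∀ K : ℝ, K₀ ≤ K →
      ∃ Gb : X × ℝ → ℝ, Continuous Gb ∧
        (∃ M : ℝ, ∀ (p : X) (v : V3), |(∑ j : Fin 3, b p j * (v - u p) j) * Gb (p, ‖v - u p‖ ^ 2)| ≤ M) ∧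
        (∀ (p : X) (v : V3), |(∑ j : Fin 3, b p j * (v - u p) j) * Gb (p, ‖v - u p‖ ^ 2)| ≤
          CB * K * (1 + ‖v‖ ^ 2)) ∧
        (∀ p, ∫ v, ((∑ j : Fin 3, b p j * (v - u p) j) * Gb (p, ‖v - u p‖ ^ 2)) *
          localMaxwellian 1 (θ p) (u p) v = 0) ∧
        (∀ p (k : Fin 3), ∫ v, ((∑ j : Fin 3, b p j * (v - u p) j) * Gb (p, ‖v - u p‖ ^ 2)) * v k *
          localMaxwellian 1 (θ p) (u p) v = 0) ∧
        (∀ p, ∫ v, ((∑ j : Fin 3, b p j * (v - u p) j) * Gb (p, ‖v - u p‖ ^ 2)) * ‖v‖ ^ 2 *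
          localMaxwellian 1 (θ p) (u p) v = 0) ∧
        (∀ (p : X) (v : V3),
          |(∑ j : Fin 3, b p j * (v - u p) j) * (‖v - u p‖ ^ 2 - 5 * θ p - G (p, ‖v - u p‖ ^ 2)) -
              (∑ j : Fin 3, b p j * (v - u p) j) * Gb (p, ‖v - u p‖ ^ 2)| ≤
            Bb * (1 + 5 * θM + C_G) * (if K < ‖v - u p‖ then ‖v - u p‖ ^ 3 else 0) +
              A * Real.exp (-(c * K))) := by
  /- Step 1 (level-free): the tent `r₀` on `[1, 3]`, the reference moment `m₀ = E[ξ₀² r₀(‖ξ‖²)] > 0`, the sextic moment. -/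
  set r₀ : ℝ → ℝ := fun t => max 0 (1 - |t - (1 + 1)|) with hr₀
  obtain ⟨hr₀c, hr₀0, hr₀1, hr₀lo, hr₀hi, hr₀one⟩ := tent_props 1 (r := r₀) fun t => by rw [hr₀]
  clear_value r₀
  have hr₀abs : ∀ t, 0 ≤ t → |r₀ t| ≤ 1 * (1 + t) := fun t ht =>
    le_mul_one_add (by rw [abs_of_nonneg (hr₀0 t)]; exact hr₀1 t) zero_le_one ht
  have hir₀ : Integrable (fun ξ : V3 => ξ 0 * ξ 0 * r₀ (‖ξ‖ ^ 2)) (stdGaussian V3) :=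
    integrable_coord_mul_weight 0 0 hr₀c hr₀abs
  set m₀ : ℝ := ∫ ξ, ξ 0 * ξ 0 * r₀ (‖ξ‖ ^ 2) ∂stdGaussian V3 with hm₀def
  have hm₀ : 0 < m₀ := by
    haveI := isOpenPosMeasure_stdGaussian_V3
    have hpt : (EuclideanSpace.single (0 : Fin 3) (Real.sqrt (1 + 1)) : V3) 0 = Real.sqrt (1 + 1) := by
      simp
    have hn : ‖(EuclideanSpace.single (0 : Fin 3) (Real.sqrt (1 + 1)) : V3)‖ ^ 2 = 1 + 1 := by
      rw [PiLp.norm_single, Real.norm_eq_abs, sq_abs, Real.sq_sqrt (by positivity)]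
    rw [hm₀def]
    refine integral_pos_of_integrable_nonneg_nonzero
      (x := (EuclideanSpace.single (0 : Fin 3) (Real.sqrt (1 + 1)) : V3)) (by fun_prop) hir₀
      (fun ξ => mul_nonneg (mul_self_nonneg _) (hr₀0 _)) ?_
    beta_reduce
    rw [hpt, hn, hr₀one, mul_one, Real.mul_self_sqrt (by positivity)]
    positivity
  clear_value m₀
  set M₃ : ℝ := ∫ ξ : V3, (1 + ‖ξ‖ ^ 2) ^ 3 ∂stdGaussian V3 with hM₃
  have hM₃0 : 0 ≤ M₃ := integral_nonneg fun ξ => by positivity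
  clear_value M₃
  set P : ℝ := 6 * θM + C_G with hPdef
  have hP0 : 0 ≤ P := by positivity
  set ρM : ℝ := 1 * 1 * P * M₃ / m₀ with hρMdef
  have hρM0 : 0 ≤ ρM := by positivity
  clear_value ρM
  refine ⟨2 * Bb * (2 + 2 * U ^ 2) + Bb * (2 + 2 * U ^ 2) * (5 * θM + C_G + ρM) + 1,
    by nlinarith [mul_nonneg hBb0 (by positivity : (0 : ℝ) ≤ 2 + 2 * U ^ 2),
      mul_nonneg (mul_nonneg hBb0 (by positivity : (0 : ℝ) ≤ 2 + 2 * U ^ 2))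
        (by positivity : (0 : ℝ) ≤ 5 * θM + C_G + ρM)], fun c hc => ?_⟩
  /- Step 2 (rate `c`): the exponential-linear tail moment and the amplitude constant `A`. -/
  set Mexp : ℝ := ∫ ξ : V3, (1 + ‖ξ‖ ^ 2) ^ 3 * Real.exp (c * Real.sqrt θM * ‖ξ‖) ∂stdGaussian V3 with hMexp
  have hMexp0 : 0 ≤ Mexp := integral_nonneg fun ξ => by positivity
  clear_value Mexp
  refine ⟨Bb * (1 + 3 * θM) * (P * Mexp / m₀), by positivity, 1, le_rfl, fun K hK => ?_⟩
  have hK0 : 0 ≤ K := zero_le_one.trans hK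
  /- Step 3 (level `K`): the cutoff `χ = χ_L`, `L = K²`. -/
  set L : ℝ := K ^ 2 with hL
  have hL0 : 0 < L := by positivity
  set χ : ℝ → ℝ := fun s => min 1 (max 0 (2 - s / L)) with hχ
  have hχlo : ∀ s, s ≤ L → χ s = 1 := cutoff_eq_one hL0 (χ := χ) fun s => by rw [hχ]
  obtain ⟨hχc, hχ0, hχ1, hχhi, -⟩ := cutoff_props hL0 (χ := χ) fun s => by rw [hχ]
  clear_value χ
  have h1χ : ∀ s, |1 - χ s| ≤ 1 := fun s => by rw [abs_of_nonneg (sub_nonneg.2 (hχ1 _))]; linarith [hχ0 s]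
  have hrs : ∀ p s, 0 ≤ s → |s - 5 * θ p - G (p, s)| ≤ s + 5 * θM + C_G := by
    intro p s hs
    have h0 := hθpos p
    refine (abs_sub _ _).trans (add_le_add ((abs_sub _ _).trans ?_) (hGbd p s hs))
    rw [abs_of_nonneg hs, abs_of_nonneg (by positivity)]
    linarith [hθM p]
  have hq : ∀ p s, 0 ≤ s → |(s - 5 * θ p - G (p, s)) * χ s| ≤ 2 * L + 5 * θM + C_G := by
    intro p s hs
    by_cases h : s ≤ 2 * L
    · rw [abs_mul, abs_of_nonneg (hχ0 s)]
      calc |s - 5 * θ p - G (p, s)| * χ s ≤ |s - 5 * θ p - G (p, s)| * 1 :=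
            mul_le_mul_of_nonneg_left (hχ1 s) (abs_nonneg _)
        _ ≤ 2 * L + 5 * θM + C_G := by rw [mul_one]; linarith [hrs p s hs]
    · rw [hχhi s (not_le.1 h).le, mul_zero, abs_zero]; positivity
  have hGM0 : 0 ≤ 2 * L + 5 * θM + C_G := by positivity
  have hlin : ∀ p t, 0 ≤ t → |θ p * t - 5 * θ p - G (p, θ p * t)| ≤ P * (1 + t) := by
    intro p t ht
    have h0 := hθpos p
    have h1 := hrs p (θ p * t) (by positivity)
    have h2 : θ p * t ≤ θM * t := mul_le_mul_of_nonneg_right (hθM p) ht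
    rw [hPdef]
    nlinarith [hθM p]
  have hqlin : ∀ p t, 0 ≤ t → |(θ p * t - 5 * θ p - G (p, θ p * t)) * χ (θ p * t)| ≤ P * (1 + t) := by
    intro p t ht
    rw [abs_mul, abs_of_nonneg (hχ0 _)]
    calc |θ p * t - 5 * θ p - G (p, θ p * t)| * χ (θ p * t) ≤ |θ p * t - 5 * θ p - G (p, θ p * t)| * 1 :=
          mul_le_mul_of_nonneg_left (hχ1 _) (abs_nonneg _)
      _ ≤ P * (1 + t) := by rw [mul_one]; exact hlin p t ht
  have hbd : ∀ (p : X) (ξ : V3),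
      |ξ 0 * ξ 0 * ((θ p * ‖ξ‖ ^ 2 - 5 * θ p - G (p, θ p * ‖ξ‖ ^ 2)) * χ (θ p * ‖ξ‖ ^ 2))| ≤
        1 * 1 * P * (1 + ‖ξ‖ ^ 2) ^ 3 := fun p ξ =>
    abs_mul_three_le (abs_coord_le' ξ 0) (abs_coord_le' ξ 0) (hqlin p _ (sq_nonneg _))
  /- Step 4: the truncated moment `R` (continuous by dominated convergence), its level-free bound, the amplitude `ρ = R/m₀`. -/
  set R : X → ℝ := fun p => ∫ ξ, ξ 0 * ξ 0 *
    ((θ p * ‖ξ‖ ^ 2 - 5 * θ p - G (p, θ p * ‖ξ‖ ^ 2)) * χ (θ p * ‖ξ‖ ^ 2)) ∂stdGaussian V3 with hR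
  have hRc : Continuous R := by
    refine continuous_of_dominated
      (bound := fun ξ : V3 => 1 * 1 * P * (1 + ‖ξ‖ ^ 2) ^ 3)
      (fun p => (by fun_prop : Continuous fun ξ : V3 => ξ 0 * ξ 0 *
        ((θ p * ‖ξ‖ ^ 2 - 5 * θ p - G (p, θ p * ‖ξ‖ ^ 2)) * χ (θ p * ‖ξ‖ ^ 2))).aestronglyMeasurable)
      (fun p => ae_of_all _ fun ξ => ?_) (integrable_one_add_norm_sq_cube.const_mul _)
      (ae_of_all _ fun ξ => by fun_prop)
    rw [Real.norm_eq_abs]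
    exact hbd p ξ
  have hRbd : ∀ p, |R p| ≤ 1 * 1 * P * M₃ := by
    intro p
    have h := norm_integral_le_of_norm_le (μ := stdGaussian V3)
      (f := fun ξ : V3 => ξ 0 * ξ 0 * ((θ p * ‖ξ‖ ^ 2 - 5 * θ p - G (p, θ p * ‖ξ‖ ^ 2)) * χ (θ p * ‖ξ‖ ^ 2)))
      (integrable_one_add_norm_sq_cube.const_mul (1 * 1 * P))
      (ae_of_all (stdGaussian V3) fun ξ => by rw [Real.norm_eq_abs]; exact hbd p ξ)
    rw [Real.norm_eq_abs, integral_const_mul, ← hM₃] at h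
    rw [hR]
    exact h
  have hRtail : ∀ p, b p ≠ 0 → |R p| ≤ P * Mexp * Real.exp (-(c * K)) := by
    intro p hb
    have h0 := hθpos p
    have hEG0 : ∫ ξ : V3, ξ 0 * ξ 0 * G (p, θ p * ‖ξ‖ ^ 2) ∂stdGaussian V3 = 0 := by
      by_contra hne
      apply hb
      ext k
      have := hEG p k
      rw [mul_eq_zero] at this
      simpa using this.resolve_right hne
    have hfull : ∫ ξ : V3, ξ 0 * ξ 0 * (θ p * ‖ξ‖ ^ 2 - 5 * θ p - G (p, θ p * ‖ξ‖ ^ 2)) ∂stdGaussian V3 = 0 := by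
      have e : ∀ ξ : V3, ξ 0 * ξ 0 * (θ p * ‖ξ‖ ^ 2 - 5 * θ p - G (p, θ p * ‖ξ‖ ^ 2)) =
          θ p * (ξ 0 * ξ 0 * (‖ξ‖ ^ 2 - 5)) - ξ 0 * ξ 0 * G (p, θ p * ‖ξ‖ ^ 2) := by
        intro ξ; ring
      have hiA : Integrable (fun ξ : V3 => θ p * (ξ 0 * ξ 0 * (‖ξ‖ ^ 2 - 5))) (stdGaussian V3) := by
        refine (integrable_coord_mul_weight 0 0 (ω := fun t => t - 5) (by fun_prop) (P := 5) fun t ht => ?_).const_mul _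
        refine (abs_sub _ _).trans ?_
        rw [abs_of_nonneg ht]; norm_num; linarith
      have hiB : Integrable (fun ξ : V3 => ξ 0 * ξ 0 * G (p, θ p * ‖ξ‖ ^ 2)) (stdGaussian V3) :=
        integrable_coord_mul_weight 0 0 (ω := fun t => G (p, θ p * t)) (by fun_prop) (P := C_G)
          fun t ht => le_mul_one_add (hGbd p _ (by positivity)) hCG0 ht
      simp_rw [e]
      rw [integral_sub hiA hiB, integral_const_mul, integral_coord_sq_mul_norm_sq_sub_five, hEG0]
      ring
    have hi_full : Integrable (fun ξ : V3 => ξ 0 * ξ 0 * (θ p * ‖ξ‖ ^ 2 - 5 * θ p - G (p, θ p * ‖ξ‖ ^ 2)))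
        (stdGaussian V3) :=
      integrable_coord_mul_weight 0 0 (ω := fun t => θ p * t - 5 * θ p - G (p, θ p * t)) (by fun_prop) (P := P) (hlin p)
    have hi_def : Integrable (fun ξ : V3 => ξ 0 * ξ 0 *
        ((θ p * ‖ξ‖ ^ 2 - 5 * θ p - G (p, θ p * ‖ξ‖ ^ 2)) * (1 - χ (θ p * ‖ξ‖ ^ 2)))) (stdGaussian V3) := by
      refine integrable_coord_mul_weight 0 0 (ω := fun t => (θ p * t - 5 * θ p - G (p, θ p * t)) * (1 - χ (θ p * t)))
        (by fun_prop) (P := P) fun t ht => ?_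
      rw [abs_mul]
      exact (mul_le_mul (hlin p t ht) (h1χ _) (abs_nonneg _) (by positivity)).trans_eq (mul_one _)
    have hsplit : R p = 0 - ∫ ξ : V3, ξ 0 * ξ 0 *
        ((θ p * ‖ξ‖ ^ 2 - 5 * θ p - G (p, θ p * ‖ξ‖ ^ 2)) * (1 - χ (θ p * ‖ξ‖ ^ 2))) ∂stdGaussian V3 := by
      rw [← hfull, ← integral_sub hi_full hi_def, hR]
      refine integral_congr_ae (ae_of_all _ fun ξ => ?_)
      simp only
      ring
    have hdom : ∀ ξ : V3, |ξ 0 * ξ 0 * ((θ p * ‖ξ‖ ^ 2 - 5 * θ p - G (p, θ p * ‖ξ‖ ^ 2)) * (1 - χ (θ p * ‖ξ‖ ^ 2)))| ≤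
        P * Real.exp (-(c * K)) * ((1 + ‖ξ‖ ^ 2) ^ 3 * Real.exp (c * Real.sqrt θM * ‖ξ‖)) := by
      intro ξ
      by_cases hsh : θ p * ‖ξ‖ ^ 2 ≤ L
      · rw [hχlo _ hsh, sub_self, mul_zero, mul_zero, abs_zero]; positivity
      · have hKs : K ^ 2 ≤ θ p * ‖ξ‖ ^ 2 := by rw [← hL]; exact (not_le.1 hsh).le
        have hone := one_le_exp_rate_of_sq_le h0 (hθM p) hc.le ξ hKs
        have h3 : |ξ 0 * ξ 0 * ((θ p * ‖ξ‖ ^ 2 - 5 * θ p - G (p, θ p * ‖ξ‖ ^ 2)) * (1 - χ (θ p * ‖ξ‖ ^ 2)))| ≤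
            1 * 1 * P * (1 + ‖ξ‖ ^ 2) ^ 3 := by
          refine abs_mul_three_le (abs_coord_le' ξ 0) (abs_coord_le' ξ 0) ?_
          rw [abs_mul]
          exact (mul_le_mul (hlin p _ (sq_nonneg _)) (h1χ _) (abs_nonneg _) (by positivity)).trans_eq (mul_one _)
        have h4 : (1 : ℝ) * 1 * P * (1 + ‖ξ‖ ^ 2) ^ 3 ≤
            1 * 1 * P * (1 + ‖ξ‖ ^ 2) ^ 3 * Real.exp (c * Real.sqrt θM * ‖ξ‖ - c * K) :=
          le_mul_of_one_le_right (by positivity) hone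
        have e : (1 : ℝ) * 1 * P * (1 + ‖ξ‖ ^ 2) ^ 3 * Real.exp (c * Real.sqrt θM * ‖ξ‖ - c * K) =
            P * Real.exp (-(c * K)) * ((1 + ‖ξ‖ ^ 2) ^ 3 * Real.exp (c * Real.sqrt θM * ‖ξ‖)) := by
          rw [sub_eq_add_neg, Real.exp_add]; ring
        linarith
    have h := norm_integral_le_of_norm_le (μ := stdGaussian V3)
      (f := fun ξ : V3 => ξ 0 * ξ 0 * ((θ p * ‖ξ‖ ^ 2 - 5 * θ p - G (p, θ p * ‖ξ‖ ^ 2)) * (1 - χ (θ p * ‖ξ‖ ^ 2))))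
      ((integrable_tailWeight (c * Real.sqrt θM)).const_mul (P * Real.exp (-(c * K))))
      (ae_of_all (stdGaussian V3) fun ξ => by rw [Real.norm_eq_abs]; exact hdom ξ)
    rw [Real.norm_eq_abs, integral_const_mul, ← hMexp] at h
    rw [hsplit, zero_sub, abs_neg]
    calc _ ≤ P * Real.exp (-(c * K)) * Mexp := h
      _ = P * Mexp * Real.exp (-(c * K)) := by ring
  set ρ : X → ℝ := fun p => R p / m₀ with hρ
  have hρc : Continuous ρ := by rw [hρ]; exact hRc.div_const _
  have hρM : ∀ p, |ρ p| ≤ ρM := fun p => by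
    rw [hρ, hρMdef]
    dsimp only
    rw [abs_div, abs_of_pos hm₀]
    exact div_le_div_of_nonneg_right (hRbd p) hm₀.le
  have hρtail : ∀ p, b p ≠ 0 → |ρ p| ≤ P * Mexp / m₀ * Real.exp (-(c * K)) := fun p hb => by
    rw [hρ]
    dsimp only
    rw [abs_div, abs_of_pos hm₀, div_mul_eq_mul_div]
    exact div_le_div_of_nonneg_right (hRtail p hb) hm₀.le
  set Cr : ℝ := P * Mexp / m₀ * Real.exp (-(c * K)) with hCr
  have hCr0 : 0 ≤ Cr := by positivity
  clear_value R ρ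
  have hr₀a : ∀ t, |r₀ t| ≤ 1 := fun t => by rw [abs_of_nonneg (hr₀0 _)]; exact hr₀1 _
  have hρr' : ∀ p t, |ρ p * r₀ t| ≤ ρM := fun p t => by
    rw [abs_mul]; exact (mul_le_mul (hρM p) (hr₀a t) (abs_nonneg _) hρM0).trans_eq (mul_one _)
  /- Step 5: the profile `Gb` and its pointwise properties. -/
  set Gb : X × ℝ → ℝ := fun q => (q.2 - 5 * θ q.1 - G (q.1, q.2)) * χ q.2 - ρ q.1 * r₀ (q.2 / θ q.1) with hGb
  have hGbc : Continuous Gb := by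
    have hd : Continuous fun q : X × ℝ => q.2 / θ q.1 :=
      continuous_snd.div (hθc.comp continuous_fst) fun q => (hθpos q.1).ne'
    have hG' : Continuous fun q : X × ℝ => G (q.1, q.2) := by simpa using hGc
    have h1 : Continuous fun q : X × ℝ => (q.2 - 5 * θ q.1 - G (q.1, q.2)) * χ q.2 := by fun_prop
    rw [hGb]
    exact h1.sub ((hρc.comp continuous_fst).mul (hr₀c.comp hd))
  set S₀ : ℝ := max (2 * L) (3 * θM) with hS₀
  have hS₀0 : 0 ≤ S₀ := le_max_of_le_left (by positivity)
  have hGhi : ∀ p s, S₀ ≤ s → Gb (p, s) = 0 := by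
    intro p s hs
    have h1 : 2 * L ≤ s := (le_max_left _ _).trans hs
    have h2 : 1 + 2 ≤ s / θ p := by
      rw [le_div_iff₀ (hθpos p)]
      calc (1 + 2) * θ p ≤ 3 * θM := by nlinarith [hθM p, hθpos p]
        _ ≤ S₀ := le_max_right _ _
        _ ≤ s := hs
    simp only [hGb]
    rw [hχhi s h1, hr₀hi _ h2]; ring
  set CG : ℝ := 2 * L + 5 * θM + C_G + ρM with hCG
  have hCG0 : 0 ≤ CG := by rw [hCG]; positivity
  have hGbbd : ∀ p s, 0 ≤ s → |Gb (p, s)| ≤ CG := fun p s hs => by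
    simp only [hGb]
    exact (abs_sub _ _).trans (add_le_add (hq p s hs) (hρr' p _))
  have hGgrowth : ∀ (p : X) (w : V3), |Gb (p, ‖w‖ ^ 2)| ≤ 2 * K * ‖w‖ + (5 * θM + C_G + ρM) := by
    intro p w
    have hw0 := norm_nonneg w
    have hcut : |(‖w‖ ^ 2 - 5 * θ p - G (p, ‖w‖ ^ 2)) * χ (‖w‖ ^ 2)| ≤ 2 * K * ‖w‖ + (5 * θM + C_G) := by
      by_cases h : ‖w‖ ^ 2 ≤ 2 * L
      · have hwK : ‖w‖ ≤ 2 * K :=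
          (pow_le_pow_iff_left₀ hw0 (by positivity) two_ne_zero).1
            (h.trans (by rw [hL]; nlinarith [sq_nonneg K]))
        rw [abs_mul, abs_of_nonneg (hχ0 _)]
        calc |‖w‖ ^ 2 - 5 * θ p - G (p, ‖w‖ ^ 2)| * χ (‖w‖ ^ 2) ≤ |‖w‖ ^ 2 - 5 * θ p - G (p, ‖w‖ ^ 2)| * 1 :=
              mul_le_mul_of_nonneg_left (hχ1 _) (abs_nonneg _)
          _ ≤ ‖w‖ ^ 2 + 5 * θM + C_G := by rw [mul_one]; exact hrs p _ (sq_nonneg _)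
          _ ≤ 2 * K * ‖w‖ + (5 * θM + C_G) := by nlinarith
      · rw [hχhi _ (not_le.1 h).le, mul_zero, abs_zero]; positivity
    simp only [hGb]
    refine (abs_sub _ _).trans ?_
    linarith [hcut, hρr' p (‖w‖ ^ 2 / θ p)]
  /- Step 6: the scalar re-orthogonalisation identity `E[ξ₀² Gb(p, θ(p)‖ξ‖²)] = R − ρ m₀ = 0`. -/
  have hscalar : ∀ p, ∫ ξ : V3, ξ 0 * ξ 0 * Gb (p, θ p * ‖ξ‖ ^ 2) ∂stdGaussian V3 = 0 := by
    intro p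
    have hGsh : ∀ ξ : V3, ξ 0 * ξ 0 * Gb (p, θ p * ‖ξ‖ ^ 2) =
        ξ 0 * ξ 0 * ((θ p * ‖ξ‖ ^ 2 - 5 * θ p - G (p, θ p * ‖ξ‖ ^ 2)) * χ (θ p * ‖ξ‖ ^ 2)) -
          ρ p * (ξ 0 * ξ 0 * r₀ (‖ξ‖ ^ 2)) := by
      intro ξ; simp only [hGb]; rw [mul_div_cancel_left₀ _ (hθpos p).ne']; ring
    have hi1 : Integrable (fun ξ : V3 => ξ 0 * ξ 0 *
        ((θ p * ‖ξ‖ ^ 2 - 5 * θ p - G (p, θ p * ‖ξ‖ ^ 2)) * χ (θ p * ‖ξ‖ ^ 2))) (stdGaussian V3) :=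
      integrable_coord_mul_weight 0 0 (ω := fun t => (θ p * t - 5 * θ p - G (p, θ p * t)) * χ (θ p * t))
        (by fun_prop) (P := P) (hqlin p)
    simp_rw [hGsh]
    rw [integral_sub hi1 (hir₀.const_mul _), integral_const_mul, ← hm₀def, hρ,
      div_mul_cancel₀ _ hm₀.ne', sub_eq_zero, hR]
  have horth' := fun p => odd_member_orth (hθpos p) (u p) (b p) (Gx := fun s => Gb (p, s))
    (by fun_prop) (C := CG) (fun s hs => hGbbd p s hs) hS₀0 (fun s hs => hGhi p s hs) (hscalar p)
  have hbw : ∀ (p : X) (v : V3), |∑ j, b p j * (v - u p) j| ≤ Bb * ‖v - u p‖ := fun p v => by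
    have hin : inner ℝ (b p) (v - u p) = ∑ j, b p j * (v - u p) j := by simp [PiLp.inner_apply, mul_comm]
    rw [← hin]
    exact (abs_real_inner_le_norm _ _).trans (mul_le_mul_of_nonneg_right (hBb p) (norm_nonneg _))
  refine ⟨Gb, hGbc, ⟨Bb * (1 + S₀) * CG, fun p v => ?_⟩, fun p v => ?_,
    fun p => (horth' p).1, fun p k => (horth' p).2.1 k, fun p => (horth' p).2.2, fun p v => ?_⟩
  · by_cases hw : S₀ ≤ ‖v - u p‖ ^ 2
    · rw [hGhi p _ hw, mul_zero, abs_zero]; positivity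
    · rw [abs_mul]
      have h1 : |∑ j, b p j * (v - u p) j| ≤ Bb * (1 + S₀) := (hbw p v).trans
        (mul_le_mul_of_nonneg_left (by nlinarith [norm_nonneg (v - u p), not_le.1 hw]) hBb0)
      exact mul_le_mul h1 (hGbbd p _ (sq_nonneg _)) (abs_nonneg _) (by positivity)
  · have h2 := hGgrowth p (v - u p)
    have hw : ‖v - u p‖ ^ 2 ≤ 2 * ‖v‖ ^ 2 + 2 * U ^ 2 := by
      have h3 := norm_sub_le v (u p)
      have h4 : ‖u p‖ ^ 2 ≤ U ^ 2 := pow_le_pow_left₀ (norm_nonneg _) (hU p) 2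
      nlinarith [norm_nonneg (v - u p), norm_nonneg v, norm_nonneg (u p), sq_nonneg (‖v‖ - ‖u p‖)]
    have hwn := norm_nonneg (v - u p)
    have h3 := growth_arith hwn hK0 (by positivity : (0 : ℝ) ≤ 5 * θM + C_G + ρM) hw
    have hv0 : (0 : ℝ) ≤ 1 + ‖v‖ ^ 2 := by positivity
    have hU2 : (0 : ℝ) ≤ 2 + 2 * U ^ 2 := by positivity
    rw [abs_mul]
    calc |∑ j, b p j * (v - u p) j| * |Gb (p, ‖v - u p‖ ^ 2)|
        ≤ Bb * ‖v - u p‖ * (2 * K * ‖v - u p‖ + (5 * θM + C_G + ρM)) :=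
          mul_le_mul (hbw p v) h2 (abs_nonneg _) (by positivity)
      _ = Bb * (‖v - u p‖ * (2 * K * ‖v - u p‖ + (5 * θM + C_G + ρM))) := by ring
      _ ≤ Bb * ((2 * K + (5 * θM + C_G + ρM)) * ((2 + 2 * U ^ 2) * (1 + ‖v‖ ^ 2))) :=
          mul_le_mul_of_nonneg_left h3 hBb0
      _ = (2 * Bb * (2 + 2 * U ^ 2) * K + Bb * (2 + 2 * U ^ 2) * (5 * θM + C_G + ρM)) * (1 + ‖v‖ ^ 2) := by ring
      _ ≤ (2 * Bb * (2 + 2 * U ^ 2) + Bb * (2 + 2 * U ^ 2) * (5 * θM + C_G + ρM) + 1) * K * (1 + ‖v‖ ^ 2) := by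
          apply mul_le_mul_of_nonneg_right _ hv0
          nlinarith [mul_nonneg (mul_nonneg hBb0 hU2) (by positivity : (0 : ℝ) ≤ 5 * θM + C_G + ρM),
            mul_nonneg hBb0 hU2]
  · have e : (∑ j, b p j * (v - u p) j) * (‖v - u p‖ ^ 2 - 5 * θ p - G (p, ‖v - u p‖ ^ 2)) -
        (∑ j, b p j * (v - u p) j) * Gb (p, ‖v - u p‖ ^ 2) =
        (∑ j, b p j * (v - u p) j) * ((‖v - u p‖ ^ 2 - 5 * θ p - G (p, ‖v - u p‖ ^ 2)) * (1 - χ (‖v - u p‖ ^ 2))) +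
          (∑ j, b p j * (v - u p) j) * (ρ p * r₀ (‖v - u p‖ ^ 2 / θ p)) := by
      simp only [hGb]; ring
    rw [e]
    refine (abs_add_le _ _).trans (add_le_add ?_ ?_)
    · by_cases hsh : ‖v - u p‖ ^ 2 ≤ L
      · rw [hχlo _ hsh, sub_self, mul_zero, mul_zero, abs_zero]
        split_ifs <;> positivity
      · have hKw : K < ‖v - u p‖ := by
          by_contra hle
          exact hsh (by rw [hL]; exact pow_le_pow_left₀ (norm_nonneg _) (not_lt.1 hle) 2)
        rw [if_pos hKw, abs_mul, abs_mul]
        have hw1 : 1 ≤ ‖v - u p‖ := hK.trans hKw.le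
        have h1 := hbw p v
        have h2 := hrs p _ (sq_nonneg ‖v - u p‖)
        have h3 := h1χ (‖v - u p‖ ^ 2)
        set x := ‖v - u p‖ with hx
        have hx0 : 0 ≤ x := norm_nonneg _
        calc |∑ j, b p j * (v - u p) j| * (|x ^ 2 - 5 * θ p - G (p, x ^ 2)| * |1 - χ (x ^ 2)|)
            ≤ Bb * x * ((x ^ 2 + 5 * θM + C_G) * 1) := by
              refine mul_le_mul h1 (mul_le_mul h2 h3 (abs_nonneg _) (by positivity)) (by positivity) (by positivity)
          _ = Bb * (x ^ 3 + (5 * θM + C_G) * x) := by ring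
          _ ≤ Bb * (x ^ 3 + (5 * θM + C_G) * x ^ 3) := by
              have hx3 : x ≤ x ^ 3 := by nlinarith [hw1, hx0]
              have h5 : (0 : ℝ) ≤ 5 * θM + C_G := by positivity
              exact mul_le_mul_of_nonneg_left (by nlinarith [mul_le_mul_of_nonneg_left hx3 h5]) hBb0
          _ = Bb * (1 + 5 * θM + C_G) * x ^ 3 := by ring
    · by_cases hb : b p = 0
      · have h0 : (∑ j, b p j * (v - u p) j) = 0 := by simp [hb]
        rw [h0, zero_mul, abs_zero]; positivity
      · have hρb := hρtail p hb
        rw [abs_mul, abs_mul]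
        by_cases ht : 1 + 2 ≤ ‖v - u p‖ ^ 2 / θ p
        · rw [hr₀hi _ ht, abs_zero, mul_zero, mul_zero]; positivity
        · have hws : ‖v - u p‖ ^ 2 ≤ 3 * θM := by
            have h := (not_le.1 ht).le
            rw [div_le_iff₀ (hθpos p)] at h
            nlinarith [hθM p, hθpos p]
          have hw3 : ‖v - u p‖ ≤ 1 + 3 * θM := by nlinarith [norm_nonneg (v - u p), sq_nonneg (‖v - u p‖ - 1)]
          calc |∑ j, b p j * (v - u p) j| * (|ρ p| * |r₀ (‖v - u p‖ ^ 2 / θ p)|)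
              ≤ Bb * ‖v - u p‖ * (P * Mexp / m₀ * Real.exp (-(c * K)) * 1) :=
                mul_le_mul (hbw p v) (mul_le_mul hρb (hr₀a _) (abs_nonneg _) (by positivity)) (by positivity)
                  (by positivity)
            _ ≤ Bb * (1 + 3 * θM) * (P * Mexp / m₀ * Real.exp (-(c * K)) * 1) := by gcongr
            _ = Bb * (1 + 3 * θM) * (P * Mexp / m₀) * Real.exp (-(c * K)) := by ring

end Summit.AtomisticToContinuum.HydrodynamicLimit.Theorems.HydroLimitProfilewiseBandBandShift

end
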